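import Literature.Computability.AlgebraicComplexity.GKSS19ReconstructionStep
import Literature.Computability.AlgebraicComplexity.GKSS19ReconstructionTools
import HarnessLib

/-!
# Guo–Kumar–Saptharishi–Solomon 2019, §3: the reconstruction — from a non-degenerate annihilator
# of `(Δ_0(P), …, Δ_m(P))` and a good shifted grid to a small circuit for `P`

Cell `val-lit`, seat t19 (literature-prover); part of the discharge programme of
`GKSS2019_mainThm` (v2, erratum A34) along the printed proof of [GKSS19, §3]. One bookkeeping
definition (`recCoeff`, the carried quantity `c_{ℓ,e} = coeff_e (P_ℓ(z + y))` indexed by the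
exponent box, `0` outside degree `≤ m`) and THEOREMS; no named facts; nothing here bears on
`VP ≠ VNP`, which is NOT proved.

Source: Z. Guo, M. Kumar, R. Saptharishi, N. Solomon, *Derandomization from algebraic hardness*,
SIAM J. Comput. 51 (2022) = arXiv:1905.00091 [GuoKumarSaptharishiSolomon2019], §3 from
"Reconstructing `P_{n+j}` from the inductive claim" to the end of "Obtaining a circuit for `P`"
(held text `paper:arxiv-1905.00091`, p0011.txt:L77–L90, p0012.txt:L1–L28).

## What is here

The induction of §3 in the tree's shared-gate-list formalism: the invariant "all
`c_{ℓ,e}`, `ℓ < L`, `e` in the box, are available" (`recCoeff`), its base case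
(`reconstruction_base`: the components `P_0, …, P_m` and their shifted coefficients are explicit
sparse polynomials), the level step (`reconstruction_level`: Lemma 24 at every point of the good
shifted grid via one graft of `Q'' ∘ (linear forms)` per point, interpolation of the top
coefficients, Euler descent), and the read-off `P = Σ_ℓ c_{ℓ,0}` (`reconstruction`), with an
explicit polynomial size bound `reconstructionBound k m d s'`.

## References
* [GuoKumarSaptharishiSolomon2019] arXiv:1905.00091, §3 (p0011.txt:L77–90, p0012.txt:L1–28).
-/

noncomputable section

open MvPolynomial

namespace Literature.Computability.AlgebraicComplexity

namespace GKSS2019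

open ArithCircuit ArithCircuit.Homogenisation Hrubes2020 Literature.Barriers.ValiantsHypothesis

universe u

variable {F : Type u} [Field F] {k : ℕ}

/-! ### The carried quantities -/

/-- The exponent vector of a box point `β ∈ {0, …, m}^k`. [cite: GuoKumarSaptharishiSolomon2019, §3 (arXiv p0012.txt:L5-20)] -/
def boxExp {m : ℕ} (β : Fin k → Fin (m + 1)) : Fin k →₀ ℕ :=
  Finsupp.equivFunOnFinite.symm fun j => (β j : ℕ)

/-- Coordinates of `boxExp`. [cite: GuoKumarSaptharishiSolomon2019, §3 (arXiv p0012.txt:L5-20)] -/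
@[simp] theorem boxExp_apply {m : ℕ} (β : Fin k → Fin (m + 1)) (j : Fin k) :
    boxExp β j = (β j : ℕ) := by
  simp [boxExp]

/-- `boxExp` is injective. [cite: GuoKumarSaptharishiSolomon2019, §3 (arXiv p0012.txt:L5-20)] -/
theorem boxExp_injective (m : ℕ) : Function.Injective (boxExp (k := k) (m := m)) := by
  intro β β' h
  funext j
  have := congrArg (fun e : Fin k →₀ ℕ => e j) h
  simp only [boxExp_apply] at this
  exact Fin.ext this

/-- The box of `AC/GKSS19ReconstructionStep` is the image of `boxExp`. [cite: GuoKumarSaptharishiSolomon2019, §3 (arXiv p0012.txt:L5-20)] -/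
theorem expBox_eq_image (k m : ℕ) :
    expBox k m = (Finset.univ : Finset (Fin k → Fin (m + 1))).image boxExp := rfl

/-- Re-indexing a sum over the box by box points. [cite: GuoKumarSaptharishiSolomon2019, §3 (arXiv p0012.txt:L5-20)] -/
theorem sum_expBox_filter {M : Type*} [AddCommMonoid M] (m : ℕ) (p : (Fin k →₀ ℕ) → Prop)
    [DecidablePred p] (g : (Fin k →₀ ℕ) → M) :
    ∑ e ∈ (expBox k m).filter p, g e =
      ∑ β ∈ (Finset.univ : Finset (Fin k → Fin (m + 1))).filter (fun β => p (boxExp β)),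
        g (boxExp β) := by
  classical
  rw [expBox_eq_image, Finset.filter_image,
    Finset.sum_image fun β _ β' _ h => boxExp_injective m h]

/-- **The carried quantity** `c_{ℓ,β}`: the `y^e`-coefficient (`e = boxExp β`) of `P_ℓ(z + y)`,
`P_ℓ` the degree-`ℓ` homogeneous component of `P` — in the print, `∂_z^{e} P_ℓ / e!` — set to `0`
for the box points of degree `> m`, which are never used.
[cite: GuoKumarSaptharishiSolomon2019, §3 "Obtaining a circuit for P" (arXiv p0012.txt:L5-20)] -/
def recCoeff (P : MvPolynomial (Fin k) F) (m ℓ : ℕ) (β : Fin k → Fin (m + 1)) :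
    MvPolynomial (Fin k) F :=
  if (boxExp β).degree ≤ m then coeff (boxExp β) (shiftR (homogeneousComponent ℓ P)) else 0

/-- Unfolding inside degree `≤ m`. [cite: GuoKumarSaptharishiSolomon2019, §3 (arXiv p0012.txt:L5-20)] -/
theorem recCoeff_of_le {P : MvPolynomial (Fin k) F} {m ℓ : ℕ} {β : Fin k → Fin (m + 1)}
    (h : (boxExp β).degree ≤ m) :
    recCoeff P m ℓ β = coeff (boxExp β) (shiftR (homogeneousComponent ℓ P)) := if_pos h

/-- Each carried quantity is homogeneous (of degree `ℓ - |e|`).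
[cite: GuoKumarSaptharishiSolomon2019, Obs. 22 (arXiv p0010.txt:L53-55)] -/
theorem isHomogeneous_recCoeff (P : MvPolynomial (Fin k) F) (m ℓ : ℕ) (β : Fin k → Fin (m + 1)) :
    (recCoeff P m ℓ β).IsHomogeneous (ℓ - (boxExp β).degree) := by
  unfold recCoeff
  split_ifs
  · exact isHomogeneous_coeff_shiftR (homogeneousComponent_isHomogeneous ℓ P) _
  · exact isHomogeneous_zero _ _ _

/-! ### A family of targets, one at a time -/

/-- Making each member of a finite family available in turn, at a uniform cost per member.
[cite: GuoKumarSaptharishiSolomon2019, §3 (arXiv p0012.txt:L5-20), "At each inductive step …"] -/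
theorem avail_family {σ : Type*} {ι : Type*} [DecidableEq ι] (T : Finset ι)
    (v : ι → MvPolynomial σ F) (cost : ℕ) {gs : List (Gate F σ)}
    (hgs : ∀ g ∈ gs, g.fanIn ≤ 2 ∧ IsPlainGate g)
    (hstep : ∀ t ∈ T, ∀ gs' : List (Gate F σ), gs <+: gs' → (∀ g ∈ gs', g.fanIn ≤ 2 ∧ IsPlainGate g) →
      ∃ gs'' : List (Gate F σ), gs' <+: gs'' ∧ (∀ g ∈ gs'', g.fanIn ≤ 2 ∧ IsPlainGate g) ∧
        gs''.length ≤ gs'.length + cost ∧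
        ∃ u : Operand F σ, u.RefsBelow gs''.length ∧ u.eval (gateValues gs'') = v t) :
    ∃ gs' : List (Gate F σ), gs <+: gs' ∧ (∀ g ∈ gs', g.fanIn ≤ 2 ∧ IsPlainGate g) ∧
      gs'.length ≤ gs.length + cost * T.card ∧
      ∀ t ∈ T, ∃ u : Operand F σ, u.RefsBelow gs'.length ∧ u.eval (gateValues gs') = v t := by
  induction T using Finset.induction_on with
  | empty => exact ⟨gs, List.prefix_rfl, hgs, by simp, fun t ht => by simp at ht⟩
  | insert a T ha ih =>
    obtain ⟨gs₁, hp₁, hg₁, hl₁, hr₁⟩ :=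
      ih (fun t ht => hstep t (Finset.mem_insert_of_mem ht))
    obtain ⟨gs₂, hp₂, hg₂, hl₂, hu₂⟩ := hstep a (Finset.mem_insert_self a T) gs₁ hp₁ hg₁
    refine ⟨gs₂, hp₁.trans hp₂, hg₂, ?_, fun t ht => ?_⟩
    · rw [Finset.card_insert_of_notMem ha]
      calc gs₂.length ≤ gs₁.length + cost := hl₂
        _ ≤ gs.length + cost * T.card + cost := Nat.add_le_add_right hl₁ _
        _ = gs.length + cost * (T.card + 1) := by ring
    · rw [Finset.mem_insert] at ht
      rcases ht with rfl | ht
      · exact hu₂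
      · exact avail_mono hp₂ (hr₁ t ht)

/-! ### Base case: `P_0, …, P_m` and their shifted coefficients are explicit -/

/-- The support of a carried quantity lies in the exponent box (it is homogeneous of degree
`≤ m` when `ℓ ≤ m`). [cite: GuoKumarSaptharishiSolomon2019, §3 (arXiv p0011.txt:L66-68), "guess each P_i explicitly as a sum of monomials"] -/
theorem card_support_recCoeff_le (P : MvPolynomial (Fin k) F) {m ℓ : ℕ} (hℓ : ℓ ≤ m)
    (β : Fin k → Fin (m + 1)) :
    (recCoeff P m ℓ β).support.card ≤ (m + 1) ^ k := by
  classical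
  refine le_trans (Finset.card_le_card fun b hb => ?_) (card_expBox_le k m)
  have hdeg : b.degree = ℓ - (boxExp β).degree := by
    have := isHomogeneous_recCoeff P m ℓ β (mem_support_iff.mp hb)
    conv_lhs => rw [Finsupp.degree_eq_weight_one]
    exact this
  exact mem_expBox_of_degree_le (by omega)

/-- **Base case.** All `c_{ℓ,β}` with `ℓ ≤ m` are available after
`(m+1)^{k+1} · (m+2)² · (m+1)^k · (2m+2)` plain gates (each is a sparse homogeneous polynomial of
degree `≤ m`, grafted by Lemma 20). [cite: GuoKumarSaptharishiSolomon2019, §3 (arXiv p0011.txt:L66-68)] -/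
theorem reconstruction_base (P : MvPolynomial (Fin k) F) (m : ℕ) :
    ∃ gs : List (Gate F (Fin k)), (∀ g ∈ gs, g.fanIn ≤ 2 ∧ IsPlainGate g) ∧
      gs.length ≤ ((m + 2) ^ 2 * ((m + 1) ^ k * (2 * m + 2))) * ((m + 1) * (m + 1) ^ k) ∧
      ∀ ℓ < m + 1, ∀ β : Fin k → Fin (m + 1), ∃ u : Operand F (Fin k), u.RefsBelow gs.length ∧
        u.eval (gateValues gs) = recCoeff P m ℓ β := by
  classical
  set T : Finset (Fin (m + 1) × (Fin k → Fin (m + 1))) := Finset.univ with hT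
  have hstep : ∀ t ∈ T, ∀ gs' : List (Gate F (Fin k)), ([] : List (Gate F (Fin k))) <+: gs' →
      (∀ g ∈ gs', g.fanIn ≤ 2 ∧ IsPlainGate g) →
      ∃ gs'' : List (Gate F (Fin k)), gs' <+: gs'' ∧ (∀ g ∈ gs'', g.fanIn ≤ 2 ∧ IsPlainGate g) ∧
        gs''.length ≤ gs'.length + (m + 2) ^ 2 * ((m + 1) ^ k * (2 * m + 2)) ∧
        ∃ u : Operand F (Fin k), u.RefsBelow gs''.length ∧
          u.eval (gateValues gs'') = recCoeff P m t.1 t.2 := by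
    intro t _ gs' _ hg'
    -- graft the explicit polynomial `c` onto the inputs `X`
    set c := recCoeff P m t.1 t.2 with hc
    obtain ⟨gs'', hp, hg'', hl'', hr''⟩ := hc_graft_complexity' (ι := Fin k) hg' (d := m) X
      (fun i => hc_X gs' m i) c
    have hdeg : (t.1 : ℕ) - (boxExp t.2).degree ≤ m := by have := t.1.isLt; omega
    refine ⟨gs'', hp, hg'', hl''.trans (Nat.add_le_add_left (Nat.mul_le_mul_left _ ?_) _), ?_⟩
    · refine (complexity_le_card_support_mul c).trans ?_
      refine Nat.mul_le_mul (card_support_recCoeff_le P (Nat.lt_succ_iff.mp t.1.isLt) t.2) ?_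
      have := (isHomogeneous_recCoeff P m t.1 t.2).totalDegree_le
      rw [← hc] at this
      have ht1 := t.1.isLt
      omega
    · have := avail_of_hc_isHomogeneous gs'' (isHomogeneous_recCoeff P m t.1 t.2) hdeg
        (by rwa [aeval_X_left_apply] at hr'')
      exact this
  obtain ⟨gs, -, hg, hl, hr⟩ := avail_family (gs := ([] : List (Gate F (Fin k)))) T
    (fun t => recCoeff P m t.1 t.2) ((m + 2) ^ 2 * ((m + 1) ^ k * (2 * m + 2)))
    (fun g hg => by simp at hg) hstep
  refine ⟨gs, hg, ?_, fun ℓ hℓ β => hr (⟨ℓ, hℓ⟩, β) (Finset.mem_univ _)⟩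
  refine hl.trans (le_of_eq ?_)
  simp [hT, Fintype.card_fin, Fintype.card_pi]

/-! ### The level step, A: Lemma 24 at every grid point via one graft per point -/

section Level

/-- The linear forms `Σ_{ℓ<L} Σ_{|e|=i} a^e X_{ℓ,e}` substituted with the carried quantities give
`R_i = Σ_{ℓ<L} Δ_i(P_ℓ)(z, a)`. [cite: GuoKumarSaptharishiSolomon2019, §3 (arXiv p0011.txt:L84-90)] -/
theorem aeval_recCoeff_linForm (P : MvPolynomial (Fin k) F) {m L : ℕ} (a : Fin k → F)
    (i : Fin (m + 1)) :
    aeval (fun p : Fin L × (Fin k → Fin (m + 1)) => recCoeff P m p.1 p.2)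
        (∑ ℓ : Fin L, ∑ β ∈ (Finset.univ : Finset (Fin k → Fin (m + 1))).filter
            (fun β => (boxExp β).degree = (i : ℕ)),
          C (∏ j, a j ^ (β j : ℕ)) * X (ℓ, β)) =
      ∑ ℓ ∈ Finset.range L, eval (fun j => (C (a j) : MvPolynomial (Fin k) F))
        (homogeneousComponent (i : ℕ) (shiftR (homogeneousComponent ℓ P))) := by
  classical
  have hi : (i : ℕ) ≤ m := Nat.lt_succ_iff.mp i.isLt
  rw [map_sum, ← Fin.sum_univ_eq_sum_range]
  refine Finset.sum_congr rfl fun ℓ _ => ?_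
  rw [eval_homogeneousComponent_shiftR_eq_sum_expBox _ a hi, sum_expBox_filter, map_sum]
  refine Finset.sum_congr rfl fun β hβ => ?_
  have hdeg : (boxExp β).degree = (i : ℕ) := (Finset.mem_filter.mp hβ).2
  rw [map_mul, aeval_C, MvPolynomial.algebraMap_eq, aeval_X, recCoeff_of_le (hdeg.le.trans hi)]
  simp only [boxExp_apply]

/-- The cost of the linear forms: `L(Σ_{ℓ<L} Σ_{|e|=i} a^e X_{ℓ,e}) ≤ L · (2 (m+1)^k + 1)`.
[cite: GuoKumarSaptharishiSolomon2019, §3 (arXiv p0012.txt:L5-20)] -/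
theorem complexity_linForm_le {m L : ℕ} (a : Fin k → F) (i : Fin (m + 1)) :
    complexity (∑ ℓ : Fin L, ∑ β ∈ (Finset.univ : Finset (Fin k → Fin (m + 1))).filter
        (fun β => (boxExp β).degree = (i : ℕ)),
          (C (∏ j, a j ^ (β j : ℕ)) * X (ℓ, β) : MvPolynomial (Fin L × (Fin k → Fin (m + 1))) F)) ≤
      L * (2 * (m + 1) ^ k + 1) := by
  classical
  refine (complexity_finset_sum_le _ _).trans ?_
  have hG : ∀ ℓ : Fin L, complexity (∑ β ∈ (Finset.univ : Finset (Fin k → Fin (m + 1))).filter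
      (fun β => (boxExp β).degree = (i : ℕ)),
        (C (∏ j, a j ^ (β j : ℕ)) * X (ℓ, β) : MvPolynomial (Fin L × (Fin k → Fin (m + 1))) F)) ≤
      2 * (m + 1) ^ k := by
    intro ℓ
    refine (complexity_finset_sum_le _ _).trans ?_
    have hcard : ((Finset.univ : Finset (Fin k → Fin (m + 1))).filter
        (fun β => (boxExp β).degree = (i : ℕ))).card ≤ (m + 1) ^ k :=
      (Finset.card_filter_le _ _).trans (by simp)
    have hterm : ∀ β : Fin k → Fin (m + 1), complexity
        (C (∏ j, a j ^ (β j : ℕ)) * X (ℓ, β) : MvPolynomial (Fin L × (Fin k → Fin (m + 1))) F) ≤ 1 :=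
      fun β => (complexity_mul_le_holds _ _).trans
        (by rw [complexity_C_holds, complexity_X_holds])
    calc _ ≤ ∑ β ∈ (Finset.univ : Finset (Fin k → Fin (m + 1))).filter
            (fun β => (boxExp β).degree = (i : ℕ)), 1 + _ :=
          Nat.add_le_add_right (Finset.sum_le_sum fun β _ => hterm β) _
      _ ≤ 2 * (m + 1) ^ k := by rw [Finset.sum_const, smul_eq_mul, mul_one]; omega
  calc _ ≤ ∑ _ℓ : Fin L, 2 * (m + 1) ^ k + (Finset.univ : Finset (Fin L)).card :=
        Nat.add_le_add_right (Finset.sum_le_sum fun ℓ _ => hG ℓ) _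
    _ = L * (2 * (m + 1) ^ k + 1) := by
        rw [Finset.sum_const, smul_eq_mul, Finset.card_univ, Fintype.card_fin]; ring

/-- **Step A of a level** (`L = m + j`, `j ≥ 1`): at every point `a = v + α` of the good shifted
grid, `Δ_m(P_L)(z, a)` becomes available — one graft (Lemma 20) of `Q'' ∘ (linear forms)` onto the
carried quantities, then Lemma 24 (`lemma24_level`) and one scalar gate.
[cite: GuoKumarSaptharishiSolomon2019, §3 "Reconstructing P_{n+j}" (arXiv p0011.txt:L77-90)] -/
theorem reconstruction_stepA (P : MvPolynomial (Fin k) F) {m d s' L : ℕ}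
    (hL1 : m + 1 ≤ L) (hL2 : L ≤ d) (Q : MvPolynomial (Fin (m + 1)) F) (hQ : complexity Q ≤ s')
    (h0 : aeval (fun i : Fin (m + 1) => homogeneousComponent (i : ℕ) (shiftR P)) Q = 0)
    (v : Fin k → F)
    (hΨ : ∀ α : Fin k → Fin (m + 1), constantCoeff (aeval (fun i : Fin (m + 1) =>
      eval (fun j => (C (v j + ((α j : ℕ) : F)) : MvPolynomial (Fin k) F))
        (homogeneousComponent (i : ℕ) (shiftR P))) (pderiv (Fin.last m) Q)) ≠ 0)
    {gs : List (Gate F (Fin k))} (hgs : ∀ g ∈ gs, g.fanIn ≤ 2 ∧ IsPlainGate g)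
    (hav : ∀ ℓ < L, ∀ β : Fin k → Fin (m + 1), ∃ u : Operand F (Fin k), u.RefsBelow gs.length ∧
      u.eval (gateValues gs) = recCoeff P m ℓ β) :
    ∃ gs' : List (Gate F (Fin k)), gs <+: gs' ∧ (∀ g ∈ gs', g.fanIn ≤ 2 ∧ IsPlainGate g) ∧
      gs'.length ≤ gs.length +
        ((d + 2) ^ 2 * (s' + (m + 1) * (d * (2 * (m + 1) ^ k + 1))) + 1) * (m + 1) ^ k ∧
      ∀ α : Fin k → Fin (m + 1), ∃ u : Operand F (Fin k), u.RefsBelow gs'.length ∧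
        u.eval (gateValues gs') = eval (fun j => (C (v j + ((α j : ℕ) : F)) : MvPolynomial (Fin k) F))
          (homogeneousComponent m (shiftR (homogeneousComponent L P))) := by
  classical
  have hfam := avail_family (gs := gs) (Finset.univ : Finset (Fin k → Fin (m + 1)))
    (fun α => eval (fun j => (C (v j + ((α j : ℕ) : F)) : MvPolynomial (Fin k) F))
      (homogeneousComponent m (shiftR (homogeneousComponent L P))))
    ((d + 2) ^ 2 * (s' + (m + 1) * (d * (2 * (m + 1) ^ k + 1))) + 1) hgs ?_
  · obtain ⟨gs', hp, hg, hl, hr⟩ := hfam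
    refine ⟨gs', hp, hg, hl.trans (le_of_eq ?_), fun α => hr α (Finset.mem_univ α)⟩
    simp [Fintype.card_pi, Fintype.card_fin]
  intro α _ gs₁ hp₁ hg₁
  set a : Fin k → F := fun j => v j + ((α j : ℕ) : F) with ha
  -- the inputs of the graft: all carried quantities of the levels `< L`
  set hfun : Fin L × (Fin k → Fin (m + 1)) → MvPolynomial (Fin k) F :=
    fun p => recCoeff P m p.1 p.2 with hhfun
  have hin : ∀ p : Fin L × (Fin k → Fin (m + 1)), ∀ e ≤ d, ∃ u : Operand F (Fin k),
      u.RefsBelow gs₁.length ∧ u.eval (gateValues gs₁) = homogeneousComponent e (hfun p) :=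
    fun p => hc_of_isHomogeneous_avail gs₁ d (isHomogeneous_recCoeff P m p.1 p.2)
      (avail_mono hp₁ (hav p.1 p.1.isLt p.2))
  -- the polynomial to graft: `Q ∘ (linear forms)`
  set lin : Fin (m + 1) → MvPolynomial (Fin L × (Fin k → Fin (m + 1))) F := fun i =>
    ∑ ℓ : Fin L, ∑ β ∈ (Finset.univ : Finset (Fin k → Fin (m + 1))).filter
        (fun β => (boxExp β).degree = (i : ℕ)), C (∏ j, a j ^ (β j : ℕ)) * X (ℓ, β) with hlin
  set f := aeval lin Q with hf
  obtain ⟨gs₂, hp₂, hg₂, hl₂, hr₂⟩ := hc_graft_complexity' hg₁ (d := d) hfun hin f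
  -- its cost
  have hfc : complexity f ≤ s' + (m + 1) * (d * (2 * (m + 1) ^ k + 1)) := by
    refine (complexity_aeval_le Q lin).trans (Nat.add_le_add hQ ?_)
    calc ∑ i, complexity (lin i) ≤ ∑ _i : Fin (m + 1), d * (2 * (m + 1) ^ k + 1) :=
          Finset.sum_le_sum fun i _ => (complexity_linForm_le a i).trans
            (Nat.mul_le_mul_right _ hL2)
      _ = (m + 1) * (d * (2 * (m + 1) ^ k + 1)) := by
          rw [Finset.sum_const, smul_eq_mul, Finset.card_univ, Fintype.card_fin]
  -- its value: `Q(R_0, …, R_m)` with `R_i = Σ_{ℓ<L} Δ_i(P_ℓ)(z, a)`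
  have hval : aeval hfun f = aeval (fun i : Fin (m + 1) => ∑ ℓ ∈ Finset.range L,
      eval (fun j => (C (v j + ((α j : ℕ) : F)) : MvPolynomial (Fin k) F))
        (homogeneousComponent (i : ℕ) (shiftR (homogeneousComponent ℓ P)))) Q := by
    rw [hf, comp_aeval_apply]
    have : (fun i => aeval hfun (lin i)) = (fun i : Fin (m + 1) => ∑ ℓ ∈ Finset.range L,
        eval (fun j => (C (v j + ((α j : ℕ) : F)) : MvPolynomial (Fin k) F))
          (homogeneousComponent (i : ℕ) (shiftR (homogeneousComponent ℓ P)))) := by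
      funext i
      simp only [hhfun, hlin]
      exact aeval_recCoeff_linForm P (fun j => v j + ((α j : ℕ) : F)) i
    rw [this]
  have hcomp : ∃ u : Operand F (Fin k), u.RefsBelow gs₂.length ∧ u.eval (gateValues gs₂) =
      homogeneousComponent (L - m) (aeval (fun i : Fin (m + 1) => ∑ ℓ ∈ Finset.range L,
        eval (fun j => (C (v j + ((α j : ℕ) : F)) : MvPolynomial (Fin k) F))
          (homogeneousComponent (i : ℕ) (shiftR (homogeneousComponent ℓ P)))) Q) := by
    have := hr₂ (L - m) (by omega)
    rwa [hval] at this
  -- Lemma 24 and one scalar gate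
  have h24 := lemma24_level P hL1 Q h0 (fun j => v j + ((α j : ℕ) : F)) (hΨ α)
  obtain ⟨gs₃, hp₃, hg₃, hl₃, hu₃⟩ := extend_smul
    (-(constantCoeff (aeval (fun i : Fin (m + 1) =>
      eval (fun j => (C (v j + ((α j : ℕ) : F)) : MvPolynomial (Fin k) F))
        (homogeneousComponent (i : ℕ) (shiftR P))) (pderiv (Fin.last m) Q)))⁻¹) hg₂ hcomp
  refine ⟨gs₃, hp₂.trans hp₃, hg₃, ?_, ?_⟩
  · have := Nat.mul_le_mul_left ((d + 2) ^ 2) hfc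
    omega
  · rw [h24]
    exact hu₃

/-! ### The level step, B: the top coefficients by interpolation on the shifted grid -/

/-- **Step B of a level**: from the values `Δ_m(P_L)(z, v + α)` on the grid, every `c_{L,e}` with
`|e| = m` by the fixed linear combination of `AC/GKSS19ReconstructionStep.coeff_shiftR_eq_sum_grid`.
[cite: GuoKumarSaptharishiSolomon2019, §3 "Reconstructing P_{n+j}" (arXiv p0011.txt:L84-90)] -/
theorem reconstruction_stepB [CharZero F] (P : MvPolynomial (Fin k) F) {m L : ℕ} (v : Fin k → F)
    {gs : List (Gate F (Fin k))} (hgs : ∀ g ∈ gs, g.fanIn ≤ 2 ∧ IsPlainGate g)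
    (hA : ∀ α : Fin k → Fin (m + 1), ∃ u : Operand F (Fin k), u.RefsBelow gs.length ∧
      u.eval (gateValues gs) = eval (fun j => (C (v j + ((α j : ℕ) : F)) : MvPolynomial (Fin k) F))
        (homogeneousComponent m (shiftR (homogeneousComponent L P)))) :
    ∃ gs' : List (Gate F (Fin k)), gs <+: gs' ∧ (∀ g ∈ gs', g.fanIn ≤ 2 ∧ IsPlainGate g) ∧
      gs'.length ≤ gs.length + (2 * (m + 1) ^ k) * (m + 1) ^ k ∧
      ∀ β : Fin k → Fin (m + 1), (boxExp β).degree = m → ∃ u : Operand F (Fin k),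
        u.RefsBelow gs'.length ∧ u.eval (gateValues gs') = recCoeff P m L β := by
  classical
  set T := (Finset.univ : Finset (Fin k → Fin (m + 1))).filter
    (fun β => (boxExp β).degree = m) with hT
  have hstep : ∀ β ∈ T, ∀ gs₁ : List (Gate F (Fin k)), gs <+: gs₁ →
      (∀ g ∈ gs₁, g.fanIn ≤ 2 ∧ IsPlainGate g) →
      ∃ gs₂ : List (Gate F (Fin k)), gs₁ <+: gs₂ ∧ (∀ g ∈ gs₂, g.fanIn ≤ 2 ∧ IsPlainGate g) ∧
        gs₂.length ≤ gs₁.length + 2 * (m + 1) ^ k ∧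
        ∃ u : Operand F (Fin k), u.RefsBelow gs₂.length ∧
          u.eval (gateValues gs₂) = recCoeff P m L β := by
    intro β hβ gs₁ hp₁ hg₁
    have hdeg : (boxExp β).degree = m := (Finset.mem_filter.mp hβ).2
    obtain ⟨gs₂, hp₂, hg₂, hl₂, hu₂⟩ := avail_linearCombination
      (Finset.univ : Finset (Fin k → Fin (m + 1)))
      (fun α => ∏ i, nodalDual (fun a : Fin (m + 1) => v i + ((a : ℕ) : F)) (boxExp β i) (α i))
      (fun α => eval (fun j => (C (v j + ((α j : ℕ) : F)) : MvPolynomial (Fin k) F))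
        (homogeneousComponent m (shiftR (homogeneousComponent L P))))
      hg₁ (fun α _ => avail_mono hp₁ (hA α))
    refine ⟨gs₂, hp₂, hg₂, hl₂.trans (by simp [Fintype.card_pi, Fintype.card_fin]), ?_⟩
    rw [recCoeff_of_le hdeg.le, coeff_shiftR_eq_sum_grid (homogeneousComponent L P) v _ hdeg]
    simp_rw [smul_eq_C_mul]
    exact hu₂
  obtain ⟨gs', hp, hg, hl, hr⟩ := avail_family (gs := gs) T (fun β => recCoeff P m L β)
    (2 * (m + 1) ^ k) hgs hstep
  refine ⟨gs', hp, hg, hl.trans (Nat.add_le_add_left (Nat.mul_le_mul_left _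
    ((Finset.card_filter_le _ _).trans (by simp [Fintype.card_pi, Fintype.card_fin]))) _),
    fun β hβ => hr β (Finset.mem_filter.mpr ⟨Finset.mem_univ β, hβ⟩)⟩

/-! ### The level step, C: Euler descent to all `|e| ≤ m` -/

/-- The box point `β + δ_j` (when `β_j < m`). [cite: GuoKumarSaptharishiSolomon2019, §3 "Obtaining a circuit for P" (arXiv p0012.txt:L5-20)] -/
theorem boxExp_update_succ {m : ℕ} (β : Fin k → Fin (m + 1)) (j : Fin k) (h : (β j : ℕ) + 1 < m + 1) :
    boxExp (Function.update β j ⟨(β j : ℕ) + 1, h⟩) = boxExp β + Finsupp.single j 1 := by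
  classical
  ext j'
  by_cases hj : j' = j
  · subst hj; simp [boxExp_apply]
  · simp [boxExp_apply, Function.update_of_ne hj, Ne.symm hj]

/-- **One round of the descent**: if all `c_{L,e}` with `m - t ≤ |e| ≤ m` are available, then so
are those with `|e| = m - t - 1`, each by the Euler identity
(`AC/GKSS19ReconstructionStep.coeff_shiftR_eq_euler`) at the cost of `3k + 1` gates.
[cite: GuoKumarSaptharishiSolomon2019, §3 "Obtaining a circuit for P" (arXiv p0012.txt:L5-28)] -/
theorem reconstruction_stepC_round [CharZero F] (P : MvPolynomial (Fin k) F) {m L : ℕ}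
    (hmL : m < L) (t : ℕ) {gs : List (Gate F (Fin k))}
    (hgs : ∀ g ∈ gs, g.fanIn ≤ 2 ∧ IsPlainGate g)
    (hD : ∀ β : Fin k → Fin (m + 1), m ≤ (boxExp β).degree + t → (boxExp β).degree ≤ m →
      ∃ u : Operand F (Fin k), u.RefsBelow gs.length ∧
        u.eval (gateValues gs) = recCoeff P m L β) :
    ∃ gs' : List (Gate F (Fin k)), gs <+: gs' ∧ (∀ g ∈ gs', g.fanIn ≤ 2 ∧ IsPlainGate g) ∧
      gs'.length ≤ gs.length + (3 * k + 1) * (m + 1) ^ k ∧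
      ∀ β : Fin k → Fin (m + 1), m ≤ (boxExp β).degree + (t + 1) → (boxExp β).degree ≤ m →
        ∃ u : Operand F (Fin k), u.RefsBelow gs'.length ∧
          u.eval (gateValues gs') = recCoeff P m L β := by
  classical
  set T := (Finset.univ : Finset (Fin k → Fin (m + 1))).filter
    (fun β => (boxExp β).degree + (t + 1) = m) with hT
  have hstep : ∀ β ∈ T, ∀ gs₁ : List (Gate F (Fin k)), gs <+: gs₁ →
      (∀ g ∈ gs₁, g.fanIn ≤ 2 ∧ IsPlainGate g) →
      ∃ gs₂ : List (Gate F (Fin k)), gs₁ <+: gs₂ ∧ (∀ g ∈ gs₂, g.fanIn ≤ 2 ∧ IsPlainGate g) ∧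
        gs₂.length ≤ gs₁.length + (3 * k + 1) ∧
        ∃ u : Operand F (Fin k), u.RefsBelow gs₂.length ∧
          u.eval (gateValues gs₂) = recCoeff P m L β := by
    intro β hβ gs₁ hp₁ hg₁
    have hdeg : (boxExp β).degree + (t + 1) = m := (Finset.mem_filter.mp hβ).2
    -- the neighbours `e + δ_j` are box points of degree `|e| + 1`, hence available
    have hlt : ∀ j : Fin k, (β j : ℕ) + 1 < m + 1 := fun j => by
      have := Finsupp.le_degree j (boxExp β)
      rw [boxExp_apply] at this
      omega
    have hnb : ∀ j : Fin k, ∃ u : Operand F (Fin k), u.RefsBelow gs₁.length ∧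
        u.eval (gateValues gs₁) = coeff (boxExp β + Finsupp.single j 1)
          (shiftR (homogeneousComponent L P)) := by
      intro j
      have hdeg' : (boxExp (Function.update β j ⟨(β j : ℕ) + 1, hlt j⟩)).degree =
          (boxExp β).degree + 1 := by
        rw [boxExp_update_succ, map_add, Finsupp.degree_single]
      have := hD (Function.update β j ⟨(β j : ℕ) + 1, hlt j⟩) (by omega) (by omega)
      rw [recCoeff_of_le (by omega), boxExp_update_succ] at this
      exact avail_mono hp₁ this
    -- the products `z_j · c_{L, e + δ_j}`
    obtain ⟨gsP, hpP, hgP, hlP, hrP⟩ := avail_family (gs := gs₁) (Finset.univ : Finset (Fin k))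
      (fun j => (X j : MvPolynomial (Fin k) F) *
        coeff (boxExp β + Finsupp.single j 1) (shiftR (homogeneousComponent L P))) 1 hg₁
      (fun j _ gs' hp' hg' => extend_mul hg' (avail_X gs' j) (avail_mono hp' (hnb j)))
    -- their linear combination and the final scalar
    obtain ⟨gsL, hpL, hgL, hlL, huL⟩ := avail_linearCombination (Finset.univ : Finset (Fin k))
      (fun j => ((boxExp β j + 1 : ℕ) : F))
      (fun j => (X j : MvPolynomial (Fin k) F) *
        coeff (boxExp β + Finsupp.single j 1) (shiftR (homogeneousComponent L P)))
      hgP (fun j hj => hrP j hj)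
    obtain ⟨gsS, hpS, hgS, hlS, huS⟩ :=
      extend_smul ((((L - (boxExp β).degree : ℕ) : F))⁻¹) hgL huL
    refine ⟨gsS, (hpP.trans hpL).trans hpS, hgS, ?_, ?_⟩
    · simp only [Finset.card_univ, Fintype.card_fin] at hlP hlL
      omega
    · rw [recCoeff_of_le (by omega),
        coeff_shiftR_eq_euler (homogeneousComponent_isHomogeneous L P) (boxExp β) (by omega)]
      simp_rw [← map_natCast (C : F →+* MvPolynomial (Fin k) F)] at huS ⊢
      exact huS
  obtain ⟨gs', hp, hg, hl, hr⟩ := avail_family (gs := gs) T (fun β => recCoeff P m L β)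
    (3 * k + 1) hgs hstep
  refine ⟨gs', hp, hg, hl.trans (Nat.add_le_add_left (Nat.mul_le_mul_left _
    ((Finset.card_filter_le _ _).trans (by simp [Fintype.card_pi, Fintype.card_fin]))) _),
    fun β h1 h2 => ?_⟩
  by_cases h : m ≤ (boxExp β).degree + t
  · exact avail_mono hp (hD β h h2)
  · exact hr β (Finset.mem_filter.mpr ⟨Finset.mem_univ β, by omega⟩)

/-- **The descent, iterated**: after `t` rounds all `c_{L,e}` with `m - t ≤ |e| ≤ m` are available.
[cite: GuoKumarSaptharishiSolomon2019, §3 "Obtaining a circuit for P" (arXiv p0012.txt:L5-28)] -/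
theorem reconstruction_stepC [CharZero F] (P : MvPolynomial (Fin k) F) {m L : ℕ} (hmL : m < L)
    {gs : List (Gate F (Fin k))} (hgs : ∀ g ∈ gs, g.fanIn ≤ 2 ∧ IsPlainGate g)
    (hB : ∀ β : Fin k → Fin (m + 1), (boxExp β).degree = m → ∃ u : Operand F (Fin k),
      u.RefsBelow gs.length ∧ u.eval (gateValues gs) = recCoeff P m L β) :
    ∀ t : ℕ, ∃ gs' : List (Gate F (Fin k)), gs <+: gs' ∧ (∀ g ∈ gs', g.fanIn ≤ 2 ∧ IsPlainGate g) ∧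
      gs'.length ≤ gs.length + ((3 * k + 1) * (m + 1) ^ k) * t ∧
      ∀ β : Fin k → Fin (m + 1), m ≤ (boxExp β).degree + t → (boxExp β).degree ≤ m →
        ∃ u : Operand F (Fin k), u.RefsBelow gs'.length ∧
          u.eval (gateValues gs') = recCoeff P m L β := by
  intro t
  induction t with
  | zero =>
    exact ⟨gs, List.prefix_rfl, hgs, by simp, fun β h1 h2 => hB β (by omega)⟩
  | succ t ih =>
    obtain ⟨gs₁, hp₁, hg₁, hl₁, hr₁⟩ := ih
    obtain ⟨gs₂, hp₂, hg₂, hl₂, hr₂⟩ := reconstruction_stepC_round P hmL t hg₁ hr₁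
    refine ⟨gs₂, hp₁.trans hp₂, hg₂, ?_, hr₂⟩
    calc gs₂.length ≤ gs₁.length + (3 * k + 1) * (m + 1) ^ k := hl₂
      _ ≤ gs.length + ((3 * k + 1) * (m + 1) ^ k) * t + (3 * k + 1) * (m + 1) ^ k :=
          Nat.add_le_add_right hl₁ _
      _ = gs.length + ((3 * k + 1) * (m + 1) ^ k) * (t + 1) := by ring

/-! ### One level, all levels, and the read-off -/

/-- The gate cost of one level (`G = (m+1)^k`): `G` grafts of `Q'' ∘ (linear forms)` with a
scalar each, `G` interpolations of `2G` gates, `m` descent rounds of `(3k+1)·G` gates.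
[cite: GuoKumarSaptharishiSolomon2019, §3 (arXiv p0012.txt:L14-20), "size(C_{j+1}) ≤ size(C_j) + poly(s', d, D')"] -/
def levelCost (k m d s' : ℕ) : ℕ :=
  ((d + 2) ^ 2 * (s' + (m + 1) * (d * (2 * (m + 1) ^ k + 1))) + 1) * (m + 1) ^ k +
    (2 * (m + 1) ^ k) * (m + 1) ^ k + ((3 * k + 1) * (m + 1) ^ k) * m

/-- **One level of the reconstruction**: from all `c_{ℓ,e}`, `ℓ < L`, to all `c_{ℓ,e}`, `ℓ ≤ L`
(`m + 1 ≤ L ≤ d`), at the cost `levelCost k m d s'`.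
[cite: GuoKumarSaptharishiSolomon2019, §3 (arXiv p0011.txt:L77-90, p0012.txt:L1-20)] -/
theorem reconstruction_level [CharZero F] (P : MvPolynomial (Fin k) F) {m d s' L : ℕ}
    (hL1 : m + 1 ≤ L) (hL2 : L ≤ d) (Q : MvPolynomial (Fin (m + 1)) F) (hQ : complexity Q ≤ s')
    (h0 : aeval (fun i : Fin (m + 1) => homogeneousComponent (i : ℕ) (shiftR P)) Q = 0)
    (v : Fin k → F)
    (hΨ : ∀ α : Fin k → Fin (m + 1), constantCoeff (aeval (fun i : Fin (m + 1) =>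
      eval (fun j => (C (v j + ((α j : ℕ) : F)) : MvPolynomial (Fin k) F))
        (homogeneousComponent (i : ℕ) (shiftR P))) (pderiv (Fin.last m) Q)) ≠ 0)
    {gs : List (Gate F (Fin k))} (hgs : ∀ g ∈ gs, g.fanIn ≤ 2 ∧ IsPlainGate g)
    (hav : ∀ ℓ < L, ∀ β : Fin k → Fin (m + 1), ∃ u : Operand F (Fin k), u.RefsBelow gs.length ∧
      u.eval (gateValues gs) = recCoeff P m ℓ β) :
    ∃ gs' : List (Gate F (Fin k)), gs <+: gs' ∧ (∀ g ∈ gs', g.fanIn ≤ 2 ∧ IsPlainGate g) ∧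
      gs'.length ≤ gs.length + levelCost k m d s' ∧
      ∀ ℓ < L + 1, ∀ β : Fin k → Fin (m + 1), ∃ u : Operand F (Fin k), u.RefsBelow gs'.length ∧
        u.eval (gateValues gs') = recCoeff P m ℓ β := by
  classical
  obtain ⟨gsA, hpA, hgA, hlA, hrA⟩ := reconstruction_stepA P hL1 hL2 Q hQ h0 v hΨ hgs hav
  obtain ⟨gsB, hpB, hgB, hlB, hrB⟩ := reconstruction_stepB P (L := L) v hgA hrA
  obtain ⟨gsC, hpC, hgC, hlC, hrC⟩ := reconstruction_stepC P (by omega : m < L) hgB hrB m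
  refine ⟨gsC, (hpA.trans hpB).trans hpC, hgC, ?_, fun ℓ hℓ β => ?_⟩
  · unfold levelCost
    omega
  · rcases Nat.lt_succ_iff_lt_or_eq.mp hℓ with hℓ | rfl
    · exact avail_mono ((hpA.trans hpB).trans hpC) (hav ℓ hℓ β)
    · by_cases hβ : (boxExp β).degree ≤ m
      · exact hrC β (by omega) hβ
      · rw [recCoeff, if_neg hβ]
        simpa using avail_C gsC (0 : F)

/-- **All levels**: `n` levels above the base, while `m + n ≤ d`.
[cite: GuoKumarSaptharishiSolomon2019, §3 (arXiv p0012.txt:L14-22)] -/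
theorem reconstruction_levels [CharZero F] (P : MvPolynomial (Fin k) F) {m d s' : ℕ}
    (Q : MvPolynomial (Fin (m + 1)) F) (hQ : complexity Q ≤ s')
    (h0 : aeval (fun i : Fin (m + 1) => homogeneousComponent (i : ℕ) (shiftR P)) Q = 0)
    (v : Fin k → F)
    (hΨ : ∀ α : Fin k → Fin (m + 1), constantCoeff (aeval (fun i : Fin (m + 1) =>
      eval (fun j => (C (v j + ((α j : ℕ) : F)) : MvPolynomial (Fin k) F))
        (homogeneousComponent (i : ℕ) (shiftR P))) (pderiv (Fin.last m) Q)) ≠ 0)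
    {gs : List (Gate F (Fin k))} (hgs : ∀ g ∈ gs, g.fanIn ≤ 2 ∧ IsPlainGate g)
    (hav : ∀ ℓ < m + 1, ∀ β : Fin k → Fin (m + 1), ∃ u : Operand F (Fin k),
      u.RefsBelow gs.length ∧ u.eval (gateValues gs) = recCoeff P m ℓ β) :
    ∀ n : ℕ, m + n ≤ d →
      ∃ gs' : List (Gate F (Fin k)), gs <+: gs' ∧ (∀ g ∈ gs', g.fanIn ≤ 2 ∧ IsPlainGate g) ∧
        gs'.length ≤ gs.length + levelCost k m d s' * n ∧
        ∀ ℓ < m + 1 + n, ∀ β : Fin k → Fin (m + 1), ∃ u : Operand F (Fin k),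
          u.RefsBelow gs'.length ∧ u.eval (gateValues gs') = recCoeff P m ℓ β := by
  intro n
  induction n with
  | zero => exact fun _ => ⟨gs, List.prefix_rfl, hgs, by simp, hav⟩
  | succ n ih =>
    intro hn
    obtain ⟨gs₁, hp₁, hg₁, hl₁, hr₁⟩ := ih (by omega)
    obtain ⟨gs₂, hp₂, hg₂, hl₂, hr₂⟩ := reconstruction_level P (d := d) (L := m + 1 + n)
      (by omega) (by omega) Q hQ h0 v hΨ hg₁ hr₁
    refine ⟨gs₂, hp₁.trans hp₂, hg₂, ?_, fun ℓ hℓ β => hr₂ ℓ (by omega) β⟩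
    calc gs₂.length ≤ gs₁.length + levelCost k m d s' := hl₂
      _ ≤ gs.length + levelCost k m d s' * n + levelCost k m d s' := Nat.add_le_add_right hl₁ _
      _ = gs.length + levelCost k m d s' * (n + 1) := by ring

/-- **The size bound of the reconstruction** (`poly(s', d, (m+1)^k, k)`): base, `d - m` levels,
read-off. [cite: GuoKumarSaptharishiSolomon2019, §3 (arXiv p0012.txt:L20-22), "The final circuit … has size poly(s, d, D, n^k)"] -/
def reconstructionBound (k m d s' : ℕ) : ℕ :=
  ((m + 2) ^ 2 * ((m + 1) ^ k * (2 * m + 2))) * ((m + 1) * (m + 1) ^ k) +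
    levelCost k m d s' * (d - m) + 2 * (d + 1)

/-- The box point `0`. [cite: GuoKumarSaptharishiSolomon2019, §3 (arXiv p0012.txt:L22-28)] -/
theorem boxExp_zero (m : ℕ) : boxExp (fun _ : Fin k => (0 : Fin (m + 1))) = 0 := by
  ext j
  simp [boxExp_apply]

/-- **GKSS §3, the reconstruction.** Let `P ∈ F[z_1..z_k]` (`char F = 0`) have degree `≤ d`, let
`Q'' ∈ F[x_0..x_m]` of complexity `≤ s'` annihilate `(Δ_0(P), …, Δ_m(P))`, and let `v + {0..m}^k`
be a grid of good points (`Ψ(a) = (∂_{x_m} Q'')(Δ(P))(0, a) ≠ 0`). Then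
`L(P) ≤ reconstructionBound k m d s'`, an explicit polynomial in `s', d, (m+1)^k, k` ("The final
circuit `C_{d-n}`, which is `G_{d-n,a}^{(0)}`, is the circuit that computes the polynomial `P` and
its size is `poly(s, d, D, n^k)`"). [cite: GuoKumarSaptharishiSolomon2019, §3 Lemma 24 to "Obtaining a circuit for P" (arXiv p0011.txt:L60-90, p0012.txt:L1-28)] -/
theorem reconstruction [CharZero F] (P : MvPolynomial (Fin k) F) {m d s' : ℕ}
    (hPd : P.totalDegree ≤ d) (Q : MvPolynomial (Fin (m + 1)) F) (hQ : complexity Q ≤ s')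
    (h0 : aeval (fun i : Fin (m + 1) => homogeneousComponent (i : ℕ) (shiftR P)) Q = 0)
    (v : Fin k → F)
    (hΨ : ∀ α : Fin k → Fin (m + 1), constantCoeff (aeval (fun i : Fin (m + 1) =>
      eval (fun j => (C (v j + ((α j : ℕ) : F)) : MvPolynomial (Fin k) F))
        (homogeneousComponent (i : ℕ) (shiftR P))) (pderiv (Fin.last m) Q)) ≠ 0) :
    complexity P ≤ reconstructionBound k m d s' := by
  classical
  obtain ⟨gs₀, hg₀, hl₀, hr₀⟩ := reconstruction_base P m
  -- all levels up to `d`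
  have hlev : ∃ gs₁ : List (Gate F (Fin k)), (∀ g ∈ gs₁, g.fanIn ≤ 2 ∧ IsPlainGate g) ∧
      gs₁.length ≤ gs₀.length + levelCost k m d s' * (d - m) ∧
      ∀ ℓ < d + 1, ∀ β : Fin k → Fin (m + 1), ∃ u : Operand F (Fin k),
        u.RefsBelow gs₁.length ∧ u.eval (gateValues gs₁) = recCoeff P m ℓ β := by
    by_cases hmd : m ≤ d
    · obtain ⟨gs₁, -, hg₁, hl₁, hr₁⟩ :=
        reconstruction_levels P (d := d) Q hQ h0 v hΨ hg₀ hr₀ (d - m) (by omega)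
      exact ⟨gs₁, hg₁, hl₁, fun ℓ hℓ β => hr₁ ℓ (by omega) β⟩
    · exact ⟨gs₀, hg₀, by omega, fun ℓ hℓ β => hr₀ ℓ (by omega) β⟩
  obtain ⟨gs₁, hg₁, hl₁, hr₁⟩ := hlev
  -- read off `P = Σ_{ℓ ≤ d} c_{ℓ,0}`
  obtain ⟨gs₂, -, hg₂, hl₂, hu₂⟩ := avail_linearCombination (Finset.range (d + 1))
    (fun _ => (1 : F)) (fun ℓ => recCoeff P m ℓ (fun _ : Fin k => (0 : Fin (m + 1)))) hg₁
    (fun ℓ hℓ => hr₁ ℓ (Finset.mem_range.mp hℓ) _)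
  have hP : ∑ ℓ ∈ Finset.range (d + 1), C (1 : F) *
      recCoeff P m ℓ (fun _ : Fin k => (0 : Fin (m + 1))) = P := by
    simp_rw [C_1, one_mul, recCoeff, boxExp_zero, map_zero, Nat.zero_le m, if_true]
    exact (eq_sum_coeff_zero_shiftR P hPd).symm
  rw [hP] at hu₂
  refine (complexity_le_length_of_avail hg₂ hu₂).trans ?_
  rw [Finset.card_range] at hl₂
  unfold reconstructionBound
  omega

end Level

end GKSS2019

end Literature.Computability.AlgebraicComplexity
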